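import Literature.MathematicalPhysics.QuantumFieldTheory.Balaban1983to89.B16NodeKnitTowerDatum
import Literature.MathematicalPhysics.QuantumFieldTheory.Balaban1983to89.B14NodeKnitTowerDatum

/-!
# `Balaban1983to89.B16NodeKnitTowerDatumJunction` — YM-DAG nodes N11 ∧ N13 AT A TOWER DATUM, BY NAME · [Balaban1988Convergent] CMP **119** Thm 1 p. 262
# with [Balaban1989LargeFieldII] CMP **122** Thm 1 p. 355 + (0.1), Cor. 3 pp. 387 ∕ 391: the junction of seat dag-n11-a's `B14NodeKnitTowerDatum` and this
# seat's `B16NodeKnitTowerDatum` on ONE represented tower at the Stage-₉ datum shape `T4DatumAssembly.datumOfTower F N M τ` — N11's (𝐑) hypothesis DISCHARGED by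
# N13's (R₉) —, the run's (B) `Dag.UVStability4D`, and the pin `B16.EndStatementBPrinted (datumOfTower F N M τ).C` ON THE DATUM from one binding world's slots

statement-level bookkeeping over published theorems with citation tags; kernel-checked compositions of tree theorems;
nothing here is a claim about the Yang–Mills mass gap.

CITATION HEADER (lean-in-tree rule).  Sources: T. Bałaban, *Convergent renormalization expansions for lattice gauge theories*, Commun. Math. Phys. **119**,
243–285 (1988) [Balaban1988Convergent] («[III]»: Thm 1 p. 262, the Theorem of p. 245, the assumed 𝐑 of p. 244, Cor. 3 (2.50) p. 264); T. Bałaban, *Large field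
renormalization. II*, Commun. Math. Phys. **122**, 355–392 (1989) [Balaban1989LargeFieldII] («[V]»: Thm 1 p. 355 + (0.1), p. 387, p. 391).  Seat `pub-ymgap-dag-n13-a`
(YM-PLAN Track A, HUMAN RULING D-0062; chair R420 ∕ R422 ∕ R424 ∕ R437 ∕ R439), module 12b of the seat.  BY NAME and UNCHANGED: `…B14NodeKnitTowerDatum` (seat
dag-n11-a: `b14_main_at_datumOfTower_repTower`, `b14_main_at_datumOfTower_lf`, `b14_main_at_datumOfTower_slots`), `…B16NodeKnitTowerDatum` (module 12:
`b16_main_at_datumOfTower_repTower`, `b16_main_at_datumOfTower_lf`, `b16_main_at_datumOfTower_slots`), `…T4DatumAssemblyTower` (seat dag-n23-a: `RGMachineCore`,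
`Tower`, `datumOfTower`), `…Node00.LargeFieldReprOfRecord` (seat node00-def-R), `…Step`, `…DagBinding` (`leavesP`, `WorldP`, `endStatementBPrinted_of_worldsP`), `…Dag`
(`B14_main` :224, `B16_main` :253, `UVStability4D` :261), `…B16` (`EndStatementBPrinted`).

WHY THIS FILE.  In print N11 ([III] Thm 1) ASSUMES the property of 𝐑 (p. 244) that N13 ([V] Thm 1) PROVES; at NODE 00's Stage-₉ datum shape both nodes read ONE
represented tower (`rep (k+1) = Rstep k (Tstep k (rep k))`, `τ.ρ P k = eval rep_k`, the core's clause «form ∧ laws»).  The two knits were landed separately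
(module 12 builds on the assembler alone); this module joins them BY NAME: N11's (𝐑) slot is fed N13's (R₉) product `∀ r, LawsT k r → Laws (k+1) (Rstep k r)`
outright, so that the pair `Dag.B14_main ∧ Dag.B16_main` at `(w, P)` needs (S0), (S1ᵀ), (R₉), the pin reading and (UV₉) — and, given the remaining in-edge
leaves as hypotheses, yields the run's (B) and the pin `B16.EndStatementBPrinted` ON THE TOWER DATUM (the (B)-conjunct of the spine item's Stage-0 text) from ONE
binding world bound to it.

WHAT THIS FILE PROVES (0 `sorry`, 0 `def`, standard axioms).  **`nodes_N11_N13_at_datumOfTower`** (generic representation data); `uvStability4D_at_datumOfTower`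
(the run's (B)); `nodes_N11_N13_at_datumOfTower_lf` (tree's §2 currency: T-half with pre-𝐑 obligations `NewT`, 𝐑-half `Repr (k+1) ∧ LFNewTerms`);
`nodes_N11_N13_at_datumOfTower_slots` (slot-family currency, `eval := densityOfRepr`); **`endStatementBPrinted_datumOfTower_of_slots`** (the pin ON THE DATUM from
one binding world's per-run ₉ slots, witnesses `w.γ`, `w.em`, `w.ep`).

HONEST FRAMING.  A count-neutral COMPOSITION (R429 (4)(i)): neither N11 nor N13 is discharged — (S1ᵀ) = the Theorem of [III] p. 245 at representation level,
(R₉) = [V] Thm 1 for 𝐑, (UV₉) = (0.1) ∕ Cor. 3 pointwise, are displayed HYPOTHESES; core, tower, data, steps, laws and the pin reading are NODE 00 Stage ₉'s;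
nothing of Bałaban's asserted or proved here.  One finite four-torus programme at fixed `ε`, Bałaban AS PRINTED with locators; nothing continuum ∕ ℝ⁴ ∕ OS ∕
mass gap ∕ Clay.
-/

noncomputable section

open MeasureTheory
open scoped BigOperators

namespace Literature.MathematicalPhysics.QuantumFieldTheory.Balaban1983to89.B16NodeKnitTowerDatumJunction

open DagBinding T4DatumAssembly T4Continuum Node00 FlowStepRuns Step
open B14NodeKnitTowerDatum (b14_main_at_datumOfTower_repTower b14_main_at_datumOfTower_lf b14_main_at_datumOfTower_slots)
open B16NodeKnitTowerDatum (b16_main_at_datumOfTower_repTower b16_main_at_datumOfTower_lf b16_main_at_datumOfTower_slots)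

variable (F : T4Family) (N : ℕ) [NeZero N]

/-! ## §1. N11 ∧ N13 at a tower datum on one represented tower; the run's (B) -/

section TowerDatum

variable (M : RGMachineCore F (SU N)) (τ : M.Tower (avOfRecord F N)) (w : WorldP) (P : B12.RunParams)
  {Rep : ℕ → Type*} (rep : (k : ℕ) → Rep k) (Tstep : (k : ℕ) → Rep k → Rep (k + 1))
  (Rstep : (k : ℕ) → Rep (k + 1) → Rep (k + 1)) (Laws : (k : ℕ) → Rep k → Prop) (LawsT : (k : ℕ) → Rep (k + 1) → Prop)
  (eval : (k : ℕ) → Rep k → Density (F.P P.K) k (SU N))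

/-- **N11 ∧ N13 AT A TOWER DATUM ON ONE REPRESENTED TOWER, BY NAME** (seat dag-n11-a's `B14NodeKnitTowerDatum.b14_main_at_datumOfTower_repTower` + this seat's
`B16NodeKnitTowerDatum.b16_main_at_datumOfTower_repTower`): under the Stage-₉ reading (`hρ`, `hS9`), from the recursion `hsucc`, (S0) `h0` the start representation
obeys the laws, (S1ᵀ) `hT` THE THEOREM OF [Balaban1988Convergent] p. 245 AT REPRESENTATION LEVEL (given N11's antecedents), (R₉) `hR9` [Balaban1989LargeFieldII]
Thm 1 for 𝐑 at representation level — which DISCHARGES N11's (𝐑) hypothesis outright —, the pin reading `hRpin` of the world's 𝐑-leaf, and (UV₉) `hUV9` at the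
core's objects below the threshold `γ₁ ≥ w.γ`. [cite: Balaban1988Convergent, Thm 1 p.262, Theorem p.245, p.244; Balaban1989LargeFieldII, Thm 1 p.355, (0.1) pp.355–356, p.387, p.391] -/
theorem nodes_N11_N13_at_datumOfTower (hC : w.C = (datumOfTower F N M τ).C)
    (hsucc : ∀ k, rep (k + 1) = Rstep k (Tstep k (rep k)))
    (hρ : ∀ k, τ.ρ P k = eval k (rep k))
    (hS9 : ∀ k, k ≤ P.K → (M.Sect2Form P k ↔ (τ.ρ P k = eval k (rep k) ∧ Laws k (rep k))))
    (h0 : (leavesP w P).smallCouplings → Laws 0 (rep 0))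
    (hT : (leavesP w P).b7 → (leavesP w P).b8 → (leavesP w P).b9 → (leavesP w P).b10 → (leavesP w P).b11 →
      (leavesP w P).smallCouplings → (leavesP w P).smallFieldInductive → (leavesP w P).flowControl →
        ∀ k, k < P.K → Laws k (rep k) → LawsT k (Tstep k (rep k)))
    (hRpin : (∀ k, k < P.K → LawsT k (Tstep k (rep k)) → Laws (k + 1) (rep (k + 1))) → (w.up P).rOperation)
    (hR9 : ∀ k, k < P.K → ∀ r : Rep (k + 1), LawsT k r → Laws (k + 1) (Rstep k r)) {γ₁ : ℝ} (hγ : w.γ ≤ γ₁)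
    (hUV9 : (genFlow M.βfun P.g0).InInterval γ₁ P.K → ∀ k, k ≤ P.K → Laws k (rep k) → ∀ U : GaugeField (F.P P.K) k (SU N),
      M.χ P k U * Real.exp (-(1 / (genSeq M.βfun P.g0 k) ^ 2 * M.wilsonBG P k U)
          - w.em (genSeq M.βfun P.g0 k) * (Fintype.card (Site (F.P P.K) k) : ℝ)) ≤ eval k (rep k) U ∧
      eval k (rep k) U ≤ Real.exp (w.ep (genSeq M.βfun P.g0 k) * (Fintype.card (Site (F.P P.K) k) : ℝ))) :
    Dag.B14_main (leavesP w P) ∧ Dag.B16_main (leavesP w P) :=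
  ⟨b14_main_at_datumOfTower_repTower F N M τ w P rep Tstep Rstep Laws LawsT eval hC hsucc hρ hS9 h0 hT fun _ => hR9,
    b16_main_at_datumOfTower_repTower F N M τ w P rep Tstep Rstep Laws LawsT eval hC hsucc hρ hS9 hRpin hR9 hγ hUV9⟩

/-- **The run's (B) `Dag.UVStability4D (leavesP w P)` AT A TOWER DATUM** («interval ⇒ §2 description ∧ (0.1)»): the slots of `nodes_N11_N13_at_datumOfTower`, GIVEN —
as hypotheses — N11's in-edge leaves `b7 … b11` (products of N04–N08), N13's `b5, b6, b13, rBasicStep`, the small-field leaf «interval ⇒ inductive assumptions»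
(N09∕N10) and the located flow step «interval ⇒ (2.6)».  Pure composition of `Dag.B14_main` and `Dag.B16_main`.
[cite: Balaban1989LargeFieldII, Thm 1 + (0.1) p.355; Balaban1988Convergent, Thm 1 p.262] -/
theorem uvStability4D_at_datumOfTower (hC : w.C = (datumOfTower F N M τ).C)
    (hsucc : ∀ k, rep (k + 1) = Rstep k (Tstep k (rep k)))
    (hρ : ∀ k, τ.ρ P k = eval k (rep k))
    (hS9 : ∀ k, k ≤ P.K → (M.Sect2Form P k ↔ (τ.ρ P k = eval k (rep k) ∧ Laws k (rep k))))
    (h0 : (leavesP w P).smallCouplings → Laws 0 (rep 0))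
    (hT : (leavesP w P).b7 → (leavesP w P).b8 → (leavesP w P).b9 → (leavesP w P).b10 → (leavesP w P).b11 →
      (leavesP w P).smallCouplings → (leavesP w P).smallFieldInductive → (leavesP w P).flowControl →
        ∀ k, k < P.K → Laws k (rep k) → LawsT k (Tstep k (rep k)))
    (hRpin : (∀ k, k < P.K → LawsT k (Tstep k (rep k)) → Laws (k + 1) (rep (k + 1))) → (w.up P).rOperation)
    (hR9 : ∀ k, k < P.K → ∀ r : Rep (k + 1), LawsT k r → Laws (k + 1) (Rstep k r)) {γ₁ : ℝ} (hγ : w.γ ≤ γ₁)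
    (hUV9 : (genFlow M.βfun P.g0).InInterval γ₁ P.K → ∀ k, k ≤ P.K → Laws k (rep k) → ∀ U : GaugeField (F.P P.K) k (SU N),
      M.χ P k U * Real.exp (-(1 / (genSeq M.βfun P.g0 k) ^ 2 * M.wilsonBG P k U)
          - w.em (genSeq M.βfun P.g0 k) * (Fintype.card (Site (F.P P.K) k) : ℝ)) ≤ eval k (rep k) U ∧
      eval k (rep k) U ≤ Real.exp (w.ep (genSeq M.βfun P.g0 k) * (Fintype.card (Site (F.P P.K) k) : ℝ)))
    (h5 : (leavesP w P).b5) (h6 : (leavesP w P).b6) (h7 : (leavesP w P).b7) (h8 : (leavesP w P).b8) (h9 : (leavesP w P).b9)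
    (h10 : (leavesP w P).b10) (h11 : (leavesP w P).b11) (h13 : (leavesP w P).b13) (hrb : (leavesP w P).rBasicStep)
    (hsf : (leavesP w P).smallCouplings → (leavesP w P).smallFieldInductive)
    (hfc : (leavesP w P).smallCouplings → (leavesP w P).flowControl) :
    Dag.UVStability4D (leavesP w P) := by
  obtain ⟨h14, h16⟩ :=
    nodes_N11_N13_at_datumOfTower F N M τ w P rep Tstep Rstep Laws LawsT eval hC hsucc hρ hS9 h0 hT hRpin hR9 hγ hUV9
  obtain ⟨hrop, huv⟩ := h16 h5 h6 h7 h9 h10 h11 h13 hrb hsf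
  have hdd : (leavesP w P).smallCouplings → (leavesP w P).densitiesDescribed := h14 h7 h8 h9 h10 h11 hsf hfc hrop
  exact fun hsc => ⟨hdd hsc, huv hdd hsc⟩

variable {G : Type*} [GaugeGroup G] {Φ 𝒢 𝔄 : Type*} {Pₛ : Params} (T : LFTower Pₛ G Φ 𝒢 𝔄) (c : LFConsts) (βc : ℝ)

/-- **N11 ∧ N13 AT A TOWER DATUM IN THE TREE'S §2 CURRENCY, BY NAME** (seat dag-n11-a's `b14_main_at_datumOfTower_lf` + this seat's `b16_main_at_datumOfTower_lf`): from the
signs under the interval hypothesis (`hsg`), (S0) the Wilson start is represented, (S1ᵀ) THE THEOREM OF [Balaban1988Convergent] p. 245 (N11's T-half with the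
pre-𝐑 obligations `NewT`, given N11's antecedents), (R₉ᴸ) N13's 𝐑-half `ReprT k → NewT k → Repr (k+1) ∧ Step.LFNewTerms T c βc k` — which DISCHARGES N11's (𝐑)
hypothesis outright —, the pin reading, and (UV₉ᴸ) at the core's objects. [cite: Balaban1988Convergent, Thm 1 p.262, Theorem p.245, p.279, p.244; Balaban1989LargeFieldII, Thm 1 p.355, (0.1) pp.355–356, p.387, p.391] -/
theorem nodes_N11_N13_at_datumOfTower_lf (hC : w.C = (datumOfTower F N M τ).C) (Repr ReprT NewT : ℕ → Prop)
    (hρ : ∀ k, τ.ρ P k = eval k (rep k))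
    (hS9 : ∀ k, k ≤ P.K →
      (M.Sect2Form P k ↔ (τ.ρ P k = eval k (rep k) ∧ (Repr k ∧ LFHyp T c k ∧ LFHypImproved T c βc k))))
    (hsg : (leavesP w P).smallCouplings → LFSigns T c βc P.K)
    (h0 : (leavesP w P).smallCouplings → Repr 0)
    (hT : (leavesP w P).b7 → (leavesP w P).b8 → (leavesP w P).b9 → (leavesP w P).b10 → (leavesP w P).b11 →
      (leavesP w P).smallCouplings → (leavesP w P).smallFieldInductive → (leavesP w P).flowControl →
        ∀ k, k < P.K → Repr k → LFHyp T c k → LFHypImproved T c βc k → ReprT k ∧ NewT k)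
    (hRpin : (∀ k, k < P.K → ReprT k → NewT k → Repr (k + 1) ∧ LFNewTerms T c βc k) → (w.up P).rOperation)
    (hR9 : ∀ k, k < P.K → ReprT k → NewT k → Repr (k + 1) ∧ LFNewTerms T c βc k) {γ₁ : ℝ} (hγ : w.γ ≤ γ₁)
    (hUV : (genFlow M.βfun P.g0).InInterval γ₁ P.K → ∀ k, k ≤ P.K → Repr k → LFHyp T c k → LFHypImproved T c βc k →
      ∀ U : GaugeField (F.P P.K) k (SU N),
        M.χ P k U * Real.exp (-(1 / (genSeq M.βfun P.g0 k) ^ 2 * M.wilsonBG P k U)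
            - w.em (genSeq M.βfun P.g0 k) * (Fintype.card (Site (F.P P.K) k) : ℝ)) ≤ eval k (rep k) U ∧
        eval k (rep k) U ≤ Real.exp (w.ep (genSeq M.βfun P.g0 k) * (Fintype.card (Site (F.P P.K) k) : ℝ))) :
    Dag.B14_main (leavesP w P) ∧ Dag.B16_main (leavesP w P) :=
  ⟨b14_main_at_datumOfTower_lf F N M τ w P rep eval T c βc hC Repr ReprT NewT hρ hS9 hsg h0 hT fun _ => hR9,
    b16_main_at_datumOfTower_lf F N M τ w P rep eval T c βc hC Repr ReprT NewT hρ hS9 hRpin hR9 hγ hUV⟩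

end TowerDatum

/-! ## §2. N11 ∧ N13 at a tower datum over the SLOT FAMILY of the (2.18) representation of record -/

section Slots

variable (M : RGMachineCore F (SU N)) (τ : M.Tower (avOfRecord F N)) (w : WorldP) (P : B12.RunParams)
variable (ν : Stage7Numerics) (Mx : ℕ) (g : ℕ → ℝ) (texpA : TexpAOfRecord F N ν Mx)
variable
  (Tstep : (k : ℕ) → (SeqOfRecord F ν Mx g P.K k → Density (F.P P.K) k (SU N)) →
    (SeqOfRecord F ν Mx g P.K (k + 1) → Density (F.P P.K) (k + 1) (SU N)))
  (Rstep : (k : ℕ) → (SeqOfRecord F ν Mx g P.K (k + 1) → Density (F.P P.K) (k + 1) (SU N)) →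
    (SeqOfRecord F ν Mx g P.K (k + 1) → Density (F.P P.K) (k + 1) (SU N)))
  (Laws : (k : ℕ) → (SeqOfRecord F ν Mx g P.K k → Density (F.P P.K) k (SU N)) → Prop)
  (LawsT : (k : ℕ) → (SeqOfRecord F ν Mx g P.K (k + 1) → Density (F.P P.K) (k + 1) (SU N)) → Prop)

/-- **N11 ∧ N13 AT A TOWER DATUM OVER THE SLOT FAMILY OF RECORD, BY NAME** (seat dag-n11-a's `b14_main_at_datumOfTower_slots` + this seat's `b16_main_at_datumOfTower_slots`):
(S0) `h0` the level-0 slot obeys `Laws 0`; (S1ᵀ) `hT` THE THEOREM OF [Balaban1988Convergent] p. 245 in slot currency (given N11's antecedents); (R₉) `hR9` on slots —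
DISCHARGING N11's (𝐑) hypothesis —; the pin reading; (UV₉) on the assembled densities `densityOfRepr … texpA P g k`.
[cite: Balaban1988Convergent, Thm 1 p.262, Theorem p.245, (2.18) p.257, p.244; Balaban1989LargeFieldII, Thm 1 p.355, (0.1) pp.355–356, p.387, p.391] -/
theorem nodes_N11_N13_at_datumOfTower_slots (hC : w.C = (datumOfTower F N M τ).C)
    (hsucc : ∀ k, texpA P g (k + 1) = Rstep k (Tstep k (texpA P g k)))
    (hρ : ∀ k, τ.ρ P k = densityOfRepr F N ν Mx texpA P g k)
    (hS9 : ∀ k, k ≤ P.K → (M.Sect2Form P k ↔ (τ.ρ P k = densityOfRepr F N ν Mx texpA P g k ∧ Laws k (texpA P g k))))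
    (h0 : (leavesP w P).smallCouplings → Laws 0 (texpA P g 0))
    (hT : (leavesP w P).b7 → (leavesP w P).b8 → (leavesP w P).b9 → (leavesP w P).b10 → (leavesP w P).b11 →
      (leavesP w P).smallCouplings → (leavesP w P).smallFieldInductive → (leavesP w P).flowControl →
        ∀ k, k < P.K → Laws k (texpA P g k) → LawsT k (Tstep k (texpA P g k)))
    (hRpin : (∀ k, k < P.K → LawsT k (Tstep k (texpA P g k)) → Laws (k + 1) (texpA P g (k + 1))) → (w.up P).rOperation)
    (hR9 : ∀ k, k < P.K →
      ∀ f : SeqOfRecord F ν Mx g P.K (k + 1) → Density (F.P P.K) (k + 1) (SU N), LawsT k f → Laws (k + 1) (Rstep k f))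
    {γ₁ : ℝ} (hγ : w.γ ≤ γ₁)
    (hUV9 : (genFlow M.βfun P.g0).InInterval γ₁ P.K → ∀ k, k ≤ P.K → Laws k (texpA P g k) → ∀ U : GaugeField (F.P P.K) k (SU N),
      M.χ P k U * Real.exp (-(1 / (genSeq M.βfun P.g0 k) ^ 2 * M.wilsonBG P k U)
          - w.em (genSeq M.βfun P.g0 k) * (Fintype.card (Site (F.P P.K) k) : ℝ)) ≤ densityOfRepr F N ν Mx texpA P g k U ∧
      densityOfRepr F N ν Mx texpA P g k U ≤ Real.exp (w.ep (genSeq M.βfun P.g0 k) * (Fintype.card (Site (F.P P.K) k) : ℝ))) :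
    Dag.B14_main (leavesP w P) ∧ Dag.B16_main (leavesP w P) :=
  ⟨b14_main_at_datumOfTower_slots F N M τ w P ν Mx g texpA Tstep Rstep Laws LawsT hC hsucc hρ hS9 h0 hT fun _ => hR9,
    b16_main_at_datumOfTower_slots F N M τ w P ν Mx g texpA Tstep Rstep Laws LawsT hC hsucc hρ hS9 hRpin hR9 hγ hUV9⟩

end Slots

/-! ## §3. The pin `B16.EndStatementBPrinted` ON THE TOWER DATUM from one binding world's per-run slots -/

section Pin

variable (M : RGMachineCore F (SU N)) (τ : M.Tower (avOfRecord F N)) (w : WorldP)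
  {Rep : B12.RunParams → ℕ → Type*} (rep : (P : B12.RunParams) → (k : ℕ) → Rep P k)
  (Tstep : (P : B12.RunParams) → (k : ℕ) → Rep P k → Rep P (k + 1))
  (Rstep : (P : B12.RunParams) → (k : ℕ) → Rep P (k + 1) → Rep P (k + 1))
  (Laws : (P : B12.RunParams) → (k : ℕ) → Rep P k → Prop) (LawsT : (P : B12.RunParams) → (k : ℕ) → Rep P (k + 1) → Prop)
  (eval : (P : B12.RunParams) → (k : ℕ) → Rep P k → Density (F.P P.K) k (SU N))

/-- **[Balaban1989LargeFieldII] Thm 1 ∧ [III] Cor. 3 — the PIN `B16.EndStatementBPrinted (datumOfTower F N M τ).C` (binder B2's hypothesis ON THE DATUM, the (B)-conjunct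
of the spine item's Stage-0 text) — from ONE binding world bound to the tower datum** (`hC`) carrying ONE REPRESENTED TOWER PER RUN, with the world's `γ > 0`, `em`,
`ep` as the witnesses (`DagBinding.endStatementBPrinted_of_worldsP`): per run the recursion, the Stage-₉ reading, (S0), (S1ᵀ), (R₉), the pin reading, (UV₉) below
`w.γ` itself at the core's objects, and N11's in-edge ∕ N13's in-edge ∕ small-field ∕ flow-step leaves.  (Over a record this is binder B2's job — seat dag-n24-a's
glue —; the datum-level form records that the ₉ slots close (B) ON THE DATUM with nothing else on the §2 ∕ (0.1) side.)
[cite: Balaban1989LargeFieldII, Thm 1 p.355 + p.391; Balaban1988Convergent, Thm 1 p.262, Cor. 3 (2.50) p.264] -/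
theorem endStatementBPrinted_datumOfTower_of_slots (hC : w.C = (datumOfTower F N M τ).C) (hγ : 0 < w.γ)
    (hsucc : ∀ P k, rep P (k + 1) = Rstep P k (Tstep P k (rep P k)))
    (hρ : ∀ P k, τ.ρ P k = eval P k (rep P k))
    (hS9 : ∀ P k, k ≤ P.K → (M.Sect2Form P k ↔ (τ.ρ P k = eval P k (rep P k) ∧ Laws P k (rep P k))))
    (h0 : ∀ P, (leavesP w P).smallCouplings → Laws P 0 (rep P 0))
    (hT : ∀ P, (leavesP w P).b7 → (leavesP w P).b8 → (leavesP w P).b9 → (leavesP w P).b10 → (leavesP w P).b11 →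
      (leavesP w P).smallCouplings → (leavesP w P).smallFieldInductive → (leavesP w P).flowControl →
        ∀ k, k < P.K → Laws P k (rep P k) → LawsT P k (Tstep P k (rep P k)))
    (hRpin : ∀ P, (∀ k, k < P.K → LawsT P k (Tstep P k (rep P k)) → Laws P (k + 1) (rep P (k + 1))) → (w.up P).rOperation)
    (hR9 : ∀ P k, k < P.K → ∀ r : Rep P (k + 1), LawsT P k r → Laws P (k + 1) (Rstep P k r))
    (hUV9 : ∀ P, (genFlow M.βfun P.g0).InInterval w.γ P.K → ∀ k, k ≤ P.K → Laws P k (rep P k) →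
      ∀ U : GaugeField (F.P P.K) k (SU N),
        M.χ P k U * Real.exp (-(1 / (genSeq M.βfun P.g0 k) ^ 2 * M.wilsonBG P k U)
            - w.em (genSeq M.βfun P.g0 k) * (Fintype.card (Site (F.P P.K) k) : ℝ)) ≤ eval P k (rep P k) U ∧
        eval P k (rep P k) U ≤ Real.exp (w.ep (genSeq M.βfun P.g0 k) * (Fintype.card (Site (F.P P.K) k) : ℝ)))
    (h5 : ∀ P, (leavesP w P).b5) (h6 : ∀ P, (leavesP w P).b6) (h7 : ∀ P, (leavesP w P).b7) (h8 : ∀ P, (leavesP w P).b8)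
    (h9 : ∀ P, (leavesP w P).b9) (h10 : ∀ P, (leavesP w P).b10) (h11 : ∀ P, (leavesP w P).b11) (h13 : ∀ P, (leavesP w P).b13)
    (hrb : ∀ P, (leavesP w P).rBasicStep)
    (hsf : ∀ P, (leavesP w P).smallCouplings → (leavesP w P).smallFieldInductive)
    (hfc : ∀ P, (leavesP w P).smallCouplings → (leavesP w P).flowControl) :
    B16.EndStatementBPrinted (datumOfTower F N M τ).C := by
  rw [← hC]
  exact endStatementBPrinted_of_worldsP w hγ fun P =>
    uvStability4D_at_datumOfTower F N M τ w P (rep P) (Tstep P) (Rstep P) (Laws P) (LawsT P) (eval P) hC (hsucc P) (hρ P)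
      (hS9 P) (h0 P) (hT P) (hRpin P) (hR9 P) le_rfl (hUV9 P) (h5 P) (h6 P) (h7 P) (h8 P) (h9 P) (h10 P) (h11 P) (h13 P)
      (hrb P) (hsf P) (hfc P)

end Pin

end Literature.MathematicalPhysics.QuantumFieldTheory.Balaban1983to89.B16NodeKnitTowerDatumJunction

end
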